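/-
Copyright: the b2b-balaban cell (near-miss cell 7), T⁴-continuum fan-out; row NE7b ROUND-2 swarm, seat
t4-ne7b-formalise-leaf-10 (gen 3; sub-row S6g′(f) of `t4/b2b-balaban-t4-ne7b-p1/LEAVES-NE7b.md`, owner's ruling
R-OWNER-22-12 (2); sequel of `HistorySiblingEntropy` (e) and of this lineage's finding F-leaf10-3).
Released under the licence of the surrounding project.
-/
import Summits.QuantumFields.BalabanUV.T4Continuum.Support.HistorySiblingEntropyShapes

/-!
# Sibling entropy bound, part 2: the JOINS OF ONE STEP against their hosts — the injection `g ↦ (host, part counts)`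
# and the multinomial theorem (row S6g′(f))

Summits-side support leaf of the T⁴-continuum cell (rung (B)+1 on a FINITE torus only; NOT infinite volume, NOT the
mass gap, NOT the Clay statement; NOT a proof of the spine estimate NE7b).  Row NE7b, route «COUNT», row S6g′; sequel of
part 1 `HistorySiblingEntropyShapes`.  [folklore] finite sums and real arithmetic; nothing is quoted from print, nothing
printed is asserted, no `[cite:]` tag, no `Prop` fact minted; constants explicit and absolute (only `2 ≤ e ≤ 3` is used).

WHAT.  §3 elementary numerics (`exp_neg_le_half_pow`, `sum_pow_le_two`, `sum_exp_le_exp`, `sum_pow_le_two_mul`,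
`exp_neg_four_mul_le`), `sum_le_sum_of_injOn'`; **`atoms_le`** (distinct atoms with one root:
`Σ e^{−G} ≤ 2e^{−C}`); **`parts_value_le`** (given the Kraft bound `B·e^{t−ρ}` below `N` nodes, the generating value of a
finite set of candidate parts at a join of step `s` is `≤ 2B·e^{−3C}` — a part of age `a` has span `≤ a − 2`, paid by
`e^{−C(a+1)}`); **`joins_step_le`** (distinct canonical joins of step `s`: `Σ e^{−G} ≤ (Σ_hosts e^{−G})·2V`, by the
injection `g ↦ (host g, count function of its parts)` — canonical injectivity — into hosts × `Finset.piAntidiag`, and the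
multinomial theorem `Finset.sum_pow_eq_sum_piAntidiag`).  Part 3 `HistorySiblingEntropyBound` closes the induction.

HONEST SCOPE.  An abstract theorem about OUR bookkeeping; its USE needs the bridge «sub-structure of a tagged genealogy
with its cluster parts (`HistoryJoins.jparts`) ↦ `Shape`» identifying leaf-05's classes (`HistoryJoinsAdm.key`: equal
ORDERED sub-structures) with equal shapes, which holds iff the ENCODING CONVENTION «each cluster lists its non-host parts
in a canonical shape-first order» is adopted — the owner's to rule (journal l.9428).  Nothing of print is asserted;
nothing of H3∕(B)∕BetaPertH is touched.  NE7b NOT proved.  HONEST DEPENDENCY (cell): continuum YM on T⁴ ⇐ BetaPertH ∧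
nine spine estimates (0/9 proved); BetaPertH ⇐ (D1) ∧ (D4) ∧ CAP+tail; G-an2-4 gates asym, D1 and NE2/3/4.  This file
changes none of it.
-/

open Finset

namespace Summit.QuantumFields.BalabanUV.T4Continuum.HistorySiblingEntropyBound

open Summit.QuantumFields.BalabanUV.T4Continuum.HistorySiblingEntropy
open Summit.QuantumFields.BalabanUV.T4Continuum.HistorySiblingMass (class_cost_le)

noncomputable section

/-! ## §3 Numerics, the atoms, the parts' generating value, the joins of one step -/

/-- `e^{−c} ≤ 2^{−n}` for `c ≥ n` (from `2 ≤ e`) [folklore] -/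
theorem exp_neg_le_half_pow (n : ℕ) {c : ℝ} (hc : (n : ℝ) ≤ c) : Real.exp (-c) ≤ (1 / 2) ^ n := by
  have h2 : (2 : ℝ) ≤ Real.exp 1 := by
    have := Real.add_one_le_exp (1 : ℝ); norm_num at this ⊢; linarith
  have h1 : Real.exp (-c) ≤ Real.exp (-1) ^ n := by
    rw [← Real.exp_nat_mul]; exact Real.exp_le_exp.2 (by linarith)
  have h3 : Real.exp (-1) ≤ 1 / 2 := by
    rw [Real.exp_neg, inv_eq_one_div]
    exact one_div_le_one_div_of_le (by norm_num) h2
  exact h1.trans (pow_le_pow_left₀ (Real.exp_pos _).le h3 n)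

/-- a geometric sum over DISTINCT exponents with ratio `≤ 1∕2` is at most `2` [folklore] -/
theorem sum_pow_le_two (S : Finset ℕ) {x : ℝ} (h0 : 0 ≤ x) (h1 : x ≤ 1 / 2) : ∑ j ∈ S, x ^ j ≤ 2 := by
  set n := S.sup id + 1 with hn
  have hsub : S ⊆ range n := fun j hj => mem_range.2 (Nat.lt_succ_of_le (le_sup (f := id) hj))
  have hx1 : x < 1 := by linarith
  calc ∑ j ∈ S, x ^ j ≤ ∑ j ∈ range n, x ^ j := sum_le_sum_of_subset_of_nonneg hsub fun _ _ _ => pow_nonneg h0 _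
    _ ≤ 1 / (1 - x) := by
        have hmul : (∑ j ∈ range n, x ^ j) * (1 - x) = 1 - x ^ n := geom_sum_mul_neg x n
        rw [le_div_iff₀ (by linarith)]
        have : 0 ≤ x ^ n := pow_nonneg h0 n
        linarith
    _ ≤ 2 := by
        rw [div_le_iff₀ (by linarith)]; linarith

/-- a sum of `e^j` over DISTINCT `j < n` is at most `e^n` (from `e − 1 ≥ 1`) [folklore] -/
theorem sum_exp_le_exp (S : Finset ℕ) {n : ℕ} (hS : ∀ j ∈ S, j < n) : ∑ j ∈ S, Real.exp j ≤ Real.exp n := by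
  have h2 : (2 : ℝ) ≤ Real.exp 1 := by
    have := Real.add_one_le_exp (1 : ℝ); norm_num at this ⊢; linarith
  have hpow : ∀ j : ℕ, Real.exp j = Real.exp 1 ^ j := fun j => by
    rw [← Real.exp_nat_mul, mul_one]
  have hsub : S ⊆ range n := fun j hj => mem_range.2 (hS j hj)
  calc ∑ j ∈ S, Real.exp j ≤ ∑ j ∈ range n, Real.exp j :=
        sum_le_sum_of_subset_of_nonneg hsub fun _ _ _ => (Real.exp_pos _).le
    _ = ∑ j ∈ range n, Real.exp 1 ^ j := sum_congr rfl fun j _ => hpow j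
    _ = (Real.exp 1 ^ n - 1) / (Real.exp 1 - 1) := geom_sum_eq (by linarith) n
    _ ≤ Real.exp 1 ^ n := by
        rw [div_le_iff₀ (by linarith)]
        have : 0 ≤ Real.exp 1 ^ n := pow_nonneg (Real.exp_pos _).le n
        nlinarith
    _ = Real.exp n := (hpow n).symm

/-- powers `V^m` over DISTINCT `m ≥ 1` with `V ≤ 1∕2` sum to at most `2V` [folklore] -/
theorem sum_pow_le_two_mul (L : Finset ℕ) (hL : ∀ m ∈ L, 1 ≤ m) {V : ℝ} (h0 : 0 ≤ V) (h1 : V ≤ 1 / 2) :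
    ∑ m ∈ L, V ^ m ≤ 2 * V := by
  have hinj : Set.InjOn (fun m => m - 1) (L : Set ℕ) := by
    intro a ha b hb h
    have := hL a ha; have := hL b hb
    simp only at h; omega
  have h := sum_pow_le_two (L.image fun m => m - 1) h0 h1
  rw [sum_image hinj] at h
  calc ∑ m ∈ L, V ^ m = ∑ m ∈ L, V * V ^ (m - 1) := by
        refine sum_congr rfl fun m hm => ?_
        rw [← pow_succ', Nat.sub_add_cancel (hL m hm)]
    _ = V * ∑ m ∈ L, V ^ (m - 1) := by rw [mul_sum]
    _ ≤ V * 2 := mul_le_mul_of_nonneg_left h h0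
    _ = 2 * V := by ring

/-- summing a nonnegative function along an injection [folklore] -/
theorem sum_le_sum_of_injOn' {ι κ : Type*} [DecidableEq κ] (S : Finset ι) (T : Finset κ) (φ : ι → κ) (F : κ → ℝ)
    (hinj : Set.InjOn φ S) (hmaps : ∀ i ∈ S, φ i ∈ T) (hF : ∀ k ∈ T, 0 ≤ F k) :
    ∑ i ∈ S, F (φ i) ≤ ∑ k ∈ T, F k := by
  rw [← sum_image (f := F) fun a ha b hb h => hinj ha hb h]
  exact sum_le_sum_of_subset_of_nonneg (image_subset_iff.2 hmaps) fun k hk _ => hF k hk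

/-- **THE ATOMS** with a given root: `Σ e^{−G} ≤ 2e^{−C}` (distinct atoms with one root differ in fatness). [folklore] -/
theorem atoms_le {C : ℝ} (hC : 1 ≤ C) (A : Finset Shape) {r : ℕ} (hA : ∀ g ∈ A, g.isAtom = true ∧ g.root = r) :
    ∑ g ∈ A, Real.exp (-G C g) ≤ 2 * Real.exp (-C) := by
  have hC0 : 0 ≤ Real.exp (-C) := (Real.exp_pos _).le
  have hG : ∀ g ∈ A, Real.exp (-G C g) = Real.exp (-C) * Real.exp (-C) ^ g.fat := by
    intro g hg
    obtain ⟨ha, hr⟩ := hA g hg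
    rw [Shape.eq_atom ha]
    simp only [G, Shape.phi, Shape.ent, Shape.fat, ← Real.exp_nat_mul, ← Real.exp_add]
    congr 1; push_cast; ring
  have hinj : Set.InjOn Shape.fat (A : Set Shape) := by
    intro a ha b hb h
    obtain ⟨ha1, ha2⟩ := hA a ha; obtain ⟨hb1, hb2⟩ := hA b hb
    have h' : a.fat = b.fat := h
    rw [Shape.eq_atom ha1, Shape.eq_atom hb1, ha2, hb2, h']
  rw [sum_congr rfl hG, ← mul_sum]
  have h := sum_pow_le_two (A.image Shape.fat) hC0 (by simpa using exp_neg_le_half_pow 1 (c := C) (by push_cast; linarith))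
  rw [sum_image hinj] at h
  calc Real.exp (-C) * ∑ g ∈ A, Real.exp (-C) ^ g.fat ≤ Real.exp (-C) * 2 := mul_le_mul_of_nonneg_left h hC0
    _ = 2 * Real.exp (-C) := by ring


/-- `e^{−4C} ≤ 1∕256` for `C ≥ 2` [folklore] -/
theorem exp_neg_four_mul_le {C : ℝ} (hC : 2 ≤ C) : Real.exp (-(4 * C)) ≤ 1 / 256 := by
  have h := exp_neg_le_half_pow 8 (c := 4 * C) (by push_cast; linarith)
  norm_num at h
  exact h

/-- a WF join has a part [folklore] -/
theorem Shape.parts_ne_nil {g : Shape} (ha : g.isAtom = false) (hw : g.WF) : g.parts ≠ .nil := by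
  cases g with
  | atom r f => simp [Shape.isAtom] at ha
  | join s h ps => exact hw.2.2.1

/-- **THE PARTS' GENERATING VALUE** at a join of step `s`: if the candidate parts are WF, canonical, with `≤ N` nodes and
events before `s`, and the Kraft bound `B·e^{t−ρ}` holds at `N` for every root `ρ` up to time `s − 1`, then
`Σ_{x ∈ U} wt x ≤ 2B·e^{−3C}`. [folklore] -/
theorem parts_value_le {C : ℝ} (hC : 2 ≤ C) {B : ℝ} (hB : 0 ≤ B) {N s : ℕ} (U : Finset Shape)
    (hU : ∀ x ∈ U, x.WF ∧ x.Canon ∧ x.nodes ≤ N ∧ x.last < s)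
    (hIH : ∀ (ρ : ℕ) (T : Finset Shape), (∀ x ∈ T, x.WF ∧ x.Canon ∧ x.nodes ≤ N ∧ x.root = ρ ∧ x.last ≤ s - 1) →
      ∑ x ∈ T, Real.exp (-G C x) ≤ B * Real.exp (((s - 1 : ℕ) : ℝ) - ρ)) :
    ∑ x ∈ U, wt C s x ≤ 2 * B * Real.exp (-(3 * C)) := by
  classical
  have hroot : ∀ x ∈ U, x.root ≤ s - 1 ∧ 1 ≤ s := fun x hx => by
    have h1 := Shape.root_le_last (hU x hx).1
    have h2 := (hU x hx).2.2.2
    constructor <;> omega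
  rw [← sum_fiberwise_of_maps_to (g := Shape.root) (t := U.image Shape.root) fun x hx => mem_image_of_mem _ hx]
  have hfib : ∀ ρ ∈ U.image Shape.root,
      ∑ x ∈ U.filter (fun x => x.root = ρ), wt C s x ≤
        B * Real.exp (-(3 * C)) * Real.exp (-(C - 1)) ^ (s - 1 - ρ) := by
    intro ρ hρ
    obtain ⟨x₀, hx₀, rfl⟩ := mem_image.1 hρ
    obtain ⟨hρs, hs1⟩ := hroot x₀ hx₀
    have hT : ∀ x ∈ U.filter (fun x => x.root = x₀.root),
        x.WF ∧ x.Canon ∧ x.nodes ≤ N ∧ x.root = x₀.root ∧ x.last ≤ s - 1 := by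
      intro x hx
      rw [mem_filter] at hx
      obtain ⟨hw, hc, hn, hl⟩ := hU x hx.1
      exact ⟨hw, hc, hn, hx.2, by omega⟩
    have h1 := hIH x₀.root _ hT
    have hwt : ∀ x ∈ U.filter (fun x => x.root = x₀.root),
        wt C s x = Real.exp (-G C x) * Real.exp (-(C * ((s + 1 - x₀.root : ℕ) + 1))) := by
      intro x hx
      rw [mem_filter] at hx
      rw [wt, ← hx.2, neg_add, Real.exp_add]
    rw [sum_congr rfl hwt, ← sum_mul]
    have hexp0 : 0 ≤ Real.exp (-(C * ((s + 1 - x₀.root : ℕ) + 1))) := (Real.exp_pos _).le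
    calc (∑ x ∈ U.filter (fun x => x.root = x₀.root), Real.exp (-G C x)) *
          Real.exp (-(C * ((s + 1 - x₀.root : ℕ) + 1)))
        ≤ B * Real.exp (((s - 1 : ℕ) : ℝ) - x₀.root) * Real.exp (-(C * ((s + 1 - x₀.root : ℕ) + 1))) :=
          mul_le_mul_of_nonneg_right h1 hexp0
      _ = B * Real.exp (-(3 * C)) * Real.exp (-(C - 1)) ^ (s - 1 - x₀.root) := by
          rw [← Real.exp_nat_mul, mul_assoc, mul_assoc, ← Real.exp_add, ← Real.exp_add]
          congr 2
          have e1 : ((s - 1 : ℕ) : ℝ) = s - 1 := by rw [Nat.cast_sub hs1]; simp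
          have e2 : ((s + 1 - x₀.root : ℕ) : ℝ) = s + 1 - x₀.root := by
            rw [Nat.cast_sub (by omega)]; push_cast; ring
          have e3 : ((s - 1 - x₀.root : ℕ) : ℝ) = s - 1 - x₀.root := by
            rw [Nat.cast_sub (by omega), Nat.cast_sub hs1]; simp
          rw [e1, e2, e3]; ring
  have hx0 : 0 ≤ Real.exp (-(C - 1)) := (Real.exp_pos _).le
  have hx1 : Real.exp (-(C - 1)) ≤ 1 / 2 := by simpa using exp_neg_le_half_pow 1 (c := C - 1) (by push_cast; linarith)
  have hinj : Set.InjOn (fun ρ => s - 1 - ρ) (U.image Shape.root : Set ℕ) := by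
    intro a ha b hb h
    obtain ⟨xa, hxa, rfl⟩ := mem_image.1 ha
    obtain ⟨xb, hxb, rfl⟩ := mem_image.1 hb
    have := (hroot xa hxa).1; have := (hroot xb hxb).1
    simp only at h; omega
  have h2 := sum_pow_le_two ((U.image Shape.root).image fun ρ => s - 1 - ρ) hx0 hx1
  rw [sum_image hinj] at h2
  calc ∑ ρ ∈ U.image Shape.root, ∑ x ∈ U.filter (fun x => x.root = ρ), wt C s x
      ≤ ∑ ρ ∈ U.image Shape.root, B * Real.exp (-(3 * C)) * Real.exp (-(C - 1)) ^ (s - 1 - ρ) := sum_le_sum hfib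
    _ = B * Real.exp (-(3 * C)) * ∑ ρ ∈ U.image Shape.root, Real.exp (-(C - 1)) ^ (s - 1 - ρ) := by rw [mul_sum]
    _ ≤ B * Real.exp (-(3 * C)) * 2 := mul_le_mul_of_nonneg_left h2 (mul_nonneg hB (Real.exp_pos _).le)
    _ = 2 * B * Real.exp (-(3 * C)) := by ring

/-- **THE JOINS WITH A GIVEN TOP STEP**: the sum over distinct canonical WF joins of step `s` is at most
(the sum over their hosts) × `2V`, `V` the generating value of all their parts — the injection `g ↦ (host, part counts)`
and the multinomial theorem. [folklore] -/
theorem joins_step_le (C : ℝ) {s : ℕ} (J : Finset Shape)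
    (hJ : ∀ g ∈ J, g.isAtom = false ∧ g.WF ∧ g.Canon ∧ g.last = s) {V : ℝ} (hV0 : 0 ≤ V) (hV1 : V ≤ 1 / 2)
    (hV : ∑ x ∈ J.biUnion (fun g => g.parts.toList.toFinset), wt C s x ≤ V) :
    ∑ g ∈ J, Real.exp (-G C g) ≤ (∑ h ∈ J.image Shape.host, Real.exp (-G C h)) * (2 * V) := by
  classical
  set U := J.biUnion (fun g => g.parts.toList.toFinset) with hUdef
  set Hs := J.image Shape.host with hHs
  set cnt : Shape → Shape → ℕ := fun g x => g.parts.toList.count x with hcnt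
  set len : Shape → ℕ := fun g => g.parts.toList.length with hlen
  have hW0 : 0 ≤ ∑ x ∈ U, wt C s x := sum_nonneg fun x _ => (wt_pos C s x).le
  have hH0 : 0 ≤ ∑ h ∈ Hs, Real.exp (-G C h) := sum_nonneg fun _ _ => (Real.exp_pos _).le
  let F : Shape × (Shape → ℕ) → ℝ := fun p =>
    Real.exp (-G C p.1) * ((Nat.multinomial U p.2 : ℝ) * ∏ x ∈ U, wt C s x ^ p.2 x)
  have hFnn : ∀ p, 0 ≤ F p := fun p =>
    mul_nonneg (Real.exp_pos _).le (mul_nonneg (Nat.cast_nonneg _) (prod_nonneg fun x _ => pow_nonneg (wt_pos C s x).le _))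
  -- fibrewise by the number of parts
  rw [← sum_fiberwise_of_maps_to (g := len) (t := J.image len) fun g hg => mem_image_of_mem _ hg]
  have hfib : ∀ m ∈ J.image len,
      ∑ g ∈ J.filter (fun g => len g = m), Real.exp (-G C g) ≤ (∑ h ∈ Hs, Real.exp (-G C h)) * V ^ m := by
    intro m _
    have hrepr : ∀ g ∈ J.filter (fun g => len g = m), Real.exp (-G C g) = F (g.host, cnt g) := by
      intro g hg
      rw [mem_filter] at hg
      obtain ⟨ha, -, -, hl⟩ := hJ g hg.1
      have hgU : g.parts.toList.toFinset ⊆ U := subset_biUnion_of_mem (fun g => g.parts.toList.toFinset) hg.1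
      have h := exp_neg_G_join C g.last g.host g.parts hgU
      rw [← Shape.eq_join ha, hl] at h
      rw [h]; simp only [F, hcnt, mul_assoc]
    have hinj : Set.InjOn (fun g => (g.host, cnt g)) (J.filter (fun g => len g = m) : Set Shape) := by
      intro a ha b hb h
      rw [coe_filter] at ha hb
      obtain ⟨ha1, -, hac, hal⟩ := hJ a ha.1
      obtain ⟨hb1, -, hbc, hbl⟩ := hJ b hb.1
      obtain ⟨hh, hk⟩ := Prod.mk.inj h
      have hca : (Shape.join s b.host a.parts).Canon := by
        have h' := hac; rw [Shape.eq_join ha1, hal, hh] at h'; exact h'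
      have hcb : (Shape.join s b.host b.parts).Canon := by
        have h' := hbc; rw [Shape.eq_join hb1, hbl] at h'; exact h'
      have hparts : a.parts = b.parts := parts_eq_of_count_eq hca hcb fun x => congrFun hk x
      rw [Shape.eq_join ha1, Shape.eq_join hb1, hal, hbl, hh, hparts]
    have hmaps : ∀ g ∈ J.filter (fun g => len g = m), (g.host, cnt g) ∈ Hs ×ˢ U.piAntidiag m := by
      intro g hg
      rw [mem_filter] at hg
      have hgU : g.parts.toList.toFinset ⊆ U := subset_biUnion_of_mem (fun g => g.parts.toList.toFinset) hg.1
      refine mem_product.2 ⟨mem_image_of_mem _ hg.1, mem_piAntidiag.2 ⟨?_, fun x hx => ?_⟩⟩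
      · rw [← hg.2, hlen]
        simp only [hcnt]
        rw [← sum_subset hgU fun x _ hx => List.count_eq_zero.2 fun hm => hx (List.mem_toFinset.2 hm)]
        exact List.sum_toFinset_count_eq_length _
      · exact hgU (List.mem_toFinset.2 (List.count_pos_iff.1 (Nat.pos_of_ne_zero hx)))
    calc ∑ g ∈ J.filter (fun g => len g = m), Real.exp (-G C g)
        = ∑ g ∈ J.filter (fun g => len g = m), F (g.host, cnt g) := sum_congr rfl hrepr
      _ ≤ ∑ p ∈ Hs ×ˢ U.piAntidiag m, F p := sum_le_sum_of_injOn' _ _ _ F hinj hmaps fun p _ => hFnn p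
      _ = (∑ h ∈ Hs, Real.exp (-G C h)) *
            ∑ k ∈ U.piAntidiag m, ((Nat.multinomial U k : ℝ) * ∏ x ∈ U, wt C s x ^ k x) := by
          rw [sum_product, sum_mul_sum]
      _ = (∑ h ∈ Hs, Real.exp (-G C h)) * (∑ x ∈ U, wt C s x) ^ m := by
          rw [Finset.sum_pow_eq_sum_piAntidiag]
      _ ≤ (∑ h ∈ Hs, Real.exp (-G C h)) * V ^ m :=
          mul_le_mul_of_nonneg_left (pow_le_pow_left₀ hW0 hV m) hH0
  have hL : ∀ m ∈ J.image len, 1 ≤ m := by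
    intro m hm
    obtain ⟨g, hg, rfl⟩ := mem_image.1 hm
    obtain ⟨ha, hw, -, -⟩ := hJ g hg
    simp only [hlen]
    exact List.length_pos_iff.2 (Parts.toList_ne_nil (Shape.parts_ne_nil ha hw))
  calc ∑ m ∈ J.image len, ∑ g ∈ J.filter (fun g => len g = m), Real.exp (-G C g)
      ≤ ∑ m ∈ J.image len, (∑ h ∈ Hs, Real.exp (-G C h)) * V ^ m := sum_le_sum hfib
    _ = (∑ h ∈ Hs, Real.exp (-G C h)) * ∑ m ∈ J.image len, V ^ m := by rw [mul_sum]
    _ ≤ (∑ h ∈ Hs, Real.exp (-G C h)) * (2 * V) :=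
        mul_le_mul_of_nonneg_left (sum_pow_le_two_mul _ hL hV0 hV1) hH0

end

end Summit.QuantumFields.BalabanUV.T4Continuum.HistorySiblingEntropyBound
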